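import Summits.QuantumFields.YangMills.Theorems.UnitScaleTiltProp7TracePairing
import HarnessLib

/-!
# Route `UnitScaleTilt`, crux K1 child «MinimiserStabilityRegPr» (stmt-QuantumFields-19200), registered stub `stub_prop7From14` (v4 828f5fb4a904d3be;
# leaf V3 «Prop 7 from a background (14)» = `T3Thm1CarrierNative.Prop7From14At`) — sub-lemma V3-D1b at a NON-FLAT background, part 2/3: THE QUADRATIC-FORM
# WEITZENBÖCK INEQUALITY ON THE TORUS AT A UNITARY SMALL-FIELD BACKGROUND — `Σ‖D_{U,ν}A_μ‖²_HS ≤ Σ_p‖(D_UA)(p)‖²_HS + Σ_x‖(D^*A)(x)‖²_HS + 2da·Σ‖A‖²_HS`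

Cell `ym3-torus` ∕ fleet seat `ym-ust-19200-p1` (HUMAN RULING D-0037, YM ladder rung R3), successor g2.  WHERE THIS SITS.  [Balaban1985Variational] (135)
(p. 298), `(D^*D_{U₀}A)_μ + (DD^*A)_μ = (Δ_{U₀}A)_μ − (𝒦A)_μ` with the curvature operator `𝒦` built from `R(U₀(∂p′)) − 1`, is PROVED in the tree at every
background (`B11Eq135Weitzenbock.eq135_torus`, over the lattice calculus `B9Eq39Adjoint` of [Balaban1985BackgroundPropagators] §A: `covD` (3.3), `curl` (3.4),
`covDstar`∕`divB` (3.8), `divP` (3.9), `plaqU`, with the adjointness identities `sum_covD_mul`, `sum_curl_mul` for any tracial additive functional).  THIS FILE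
pairs (135) with `A` for a UNITARY background `U : Fin d → T^{(i)} → U(N) ⊂ M_N(ℂ)ˣ` using the real trace pairing `Re Tr X^*Y` of part 1 (`(R(u)X)^* = R(u)X^*`
makes `Re Tr` compatible with the covariant derivatives), obtaining the three quadratic forms as Hilbert–Schmidt sums, and bounds the curvature pairing under the
small-field hypothesis `‖U(∂p) − 1‖ ≤ a` (print's (14): `a = C₁B₃ε₁η²(L^jη)^{−2}`, i.e. `O(ε)L^{−2k}` at the top scale — the same order as the Poincaré rate
`L^{−2k}` of Thm 3.11, hence absorbed for `ε` small ABSOLUTELY).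

WHAT IS PROVED (sorry-free, no definition; our own statements — [folklore] ∕ cited to the printed step they instantiate; `T = B9TorusCalculus.torusT P i`):
* the adjoint commutes with the unitary-background operators: `conjTranspose_covD` ∕ `_covDstar` ∕ `_curl` ∕ `_divB`; `Re Tr` is tracial (`re_trace_mul_comm`);
* **`sum_re_trace_vecLap`**: `Σ_xΣ_μ Re Tr(A_μ(x)^*(Δ_UA)_μ(x)) = Σ_xΣ_μΣ_ν‖(D_{U,ν}A_μ)(x)‖²_HS`; **`sum_re_trace_divP_curl`**: `Σ Re Tr(A^*·D^*D_UA) = Σ_{x,μ<ν}‖(D_UA)(p_{μν}(x))‖²_HS`;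
  **`sum_re_trace_covD_divB`**: `Σ Re Tr(A^*·DD^*A) = Σ_x‖(D^*A)(x)‖²_HS` (`‖X‖²_HS = Σ_{jk}|X_jk|²`);
* **`abs_sum_re_trace_curvOp_le`**: `‖U(∂p) − 1‖ ≤ a` for all plaquettes ⇒ `|Σ Re Tr(A^*·𝒦A)| ≤ 2da·Σ_xΣ_μ‖A_μ(x)‖²_HS` (part 1's `abs_re_trace_curv_le` per summand,
  `‖U(∂p′) − 1‖ ≤ ‖U(∂p) − 1‖` from `B11Eq135Weitzenbock.norm_plaqU'_sub_one_le`, shift invariance of the site sum);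
* **`sum_covD_sq_le_curl_sq_add_divB_sq`**: `Σ_xΣ_μΣ_ν‖(D_{U,ν}A_μ)(x)‖²_HS ≤ Σ_{x,μ<ν}‖(D_UA)(p_{μν}(x))‖²_HS + Σ_x‖(D^*A)(x)‖²_HS + 2da·Σ_xΣ_μ‖A_μ(x)‖²_HS`.

References: T. Bałaban, CMP 102 (1985) 277–309 [Balaban1985Variational] ((135)–(136) p.298, (14) p.280); CMP 99 (1985) 389–434 [Balaban1985BackgroundPropagators]
((3.3)–(3.4) pp.390–391, (3.8)–(3.10) p.392, (3.23) p.394, Thm 3.11 p.416).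
-/

noncomputable section

open scoped BigOperators Matrix.Norms.L2Operator Matrix

namespace Summit.QuantumFields.YangMills.Theorems.Prop7CovariantCoercivity

open Literature.MathematicalPhysics.QuantumFieldTheory.Balaban1983to89
open Finset B1RG242Torus
open B7Prop1Explicit (plaqWord U1)
open B7Eq78Linearization (conjR conjR_apply)
open B9Eq39Adjoint (R R_def covD covDstar curl divB divP plaqU curl_self curl_swap sum_covD_mul sum_sum_covD_mul sum_curl_mul trace_R)
open B11Eq135Weitzenbock (vecLap curvOp hodgeOp transp plaqU' eq135_torus vecLap_def curvOp_def hodgeOp_def norm_plaqU'_sub_one_le)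
open B9TorusCalculus (torusT torusT_apply torusT_symm_apply torusT_comm)

variable {N : ℕ} [NeZero N]

/-! ## §2 The quadratic-form Weitzenböck identity on the torus at a unitary background ([Balaban1985Variational] (135) paired with `A`) -/

section Torus

variable {P : Params} {i : ℕ}

omit [NeZero N] in
/-- The inverse of a unitary unit is unitary. [folklore] -/
theorem inv_mem_unitary {u : (Matrix (Fin N) (Fin N) ℂ)ˣ} (hu : (u : Matrix (Fin N) (Fin N) ℂ) ∈ unitary (Matrix (Fin N) (Fin N) ℂ)) :
    ((u⁻¹ : (Matrix (Fin N) (Fin N) ℂ)ˣ) : Matrix (Fin N) (Fin N) ℂ) ∈ unitary (Matrix (Fin N) (Fin N) ℂ) := by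
  rw [coe_inv_eq_star hu]; exact Unitary.star_mem hu

/-- A unitary unit lies in `U1` (norm `≤ 1`, inverse of norm `≤ 1`). [folklore] -/
theorem mem_U1_of_unitary {u : (Matrix (Fin N) (Fin N) ℂ)ˣ} (hu : (u : Matrix (Fin N) (Fin N) ℂ) ∈ unitary (Matrix (Fin N) (Fin N) ℂ)) :
    u ∈ U1 (Matrix (Fin N) (Fin N) ℂ) := by
  letI : CStarAlgebra (Matrix (Fin N) (Fin N) ℂ) := B10Eq29TubeLine.cstarAlgebraMatrix N
  exact B7Prop2Explicit.unitaryUnits_le_U1 (B7Prop2Explicit.mem_unitaryUnits.mpr hu)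

variable {U : Fin P.d → Site P i → (Matrix (Fin N) (Fin N) ℂ)ˣ}

omit [NeZero N] in
/-- `(D_{U,ν}f)^* = D_{U,ν}(f^*)` for a unitary background. [cite: Balaban1985BackgroundPropagators, (3.3) p.390] -/
theorem conjTranspose_covD (hU : ∀ ν x, (U ν x : Matrix (Fin N) (Fin N) ℂ) ∈ unitary (Matrix (Fin N) (Fin N) ℂ))
    (ν : Fin P.d) (f : Site P i → Matrix (Fin N) (Fin N) ℂ) (x : Site P i) :
    (covD (torusT P i) U ν f x)ᴴ = covD (torusT P i) U ν (fun z => (f z)ᴴ) x := by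
  simp only [covD, Matrix.conjTranspose_sub, conjTranspose_R (hU ν x)]

omit [NeZero N] in
/-- `(D*_{U,ν}f)^* = D*_{U,ν}(f^*)` for a unitary background. [cite: Balaban1985BackgroundPropagators, (3.8) p.392] -/
theorem conjTranspose_covDstar (hU : ∀ ν x, (U ν x : Matrix (Fin N) (Fin N) ℂ) ∈ unitary (Matrix (Fin N) (Fin N) ℂ))
    (ν : Fin P.d) (f : Site P i → Matrix (Fin N) (Fin N) ℂ) (x : Site P i) :
    (covDstar (torusT P i) U ν f x)ᴴ = covDstar (torusT P i) U ν (fun z => (f z)ᴴ) x := by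
  simp only [covDstar, Matrix.conjTranspose_sub, conjTranspose_R (inv_mem_unitary (hU ν _))]

omit [NeZero N] in
/-- `(D_UA)(p)^* = (D_UA^*)(p)` for a unitary background. [cite: Balaban1985BackgroundPropagators, (3.4) p.391] -/
theorem conjTranspose_curl (hU : ∀ ν x, (U ν x : Matrix (Fin N) (Fin N) ℂ) ∈ unitary (Matrix (Fin N) (Fin N) ℂ))
    (A : Fin P.d → Site P i → Matrix (Fin N) (Fin N) ℂ) (μ ν : Fin P.d) (x : Site P i) :
    (curl (torusT P i) U A μ ν x)ᴴ = curl (torusT P i) U (fun κ z => (A κ z)ᴴ) μ ν x := by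
  simp only [curl, Matrix.conjTranspose_sub, conjTranspose_covD hU]

omit [NeZero N] in
/-- `(D*A)(x)^* = (D*A^*)(x)` for a unitary background. [cite: Balaban1985BackgroundPropagators, (3.8) p.392] -/
theorem conjTranspose_divB (hU : ∀ ν x, (U ν x : Matrix (Fin N) (Fin N) ℂ) ∈ unitary (Matrix (Fin N) (Fin N) ℂ))
    (A : Fin P.d → Site P i → Matrix (Fin N) (Fin N) ℂ) (x : Site P i) :
    (divB (torusT P i) U A x)ᴴ = divB (torusT P i) U (fun κ z => (A κ z)ᴴ) x := by
  simp only [divB, Matrix.conjTranspose_sum, conjTranspose_covDstar hU]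

omit [NeZero N] in
/-- The real trace is tracial: `Re Tr(ab) = Re Tr(ba)`. [folklore] -/
theorem re_trace_mul_comm (a b : Matrix (Fin N) (Fin N) ℂ) :
    (Complex.reAddGroupHom.comp (Matrix.traceAddMonoidHom (Fin N) ℂ)) (a * b)
      = (Complex.reAddGroupHom.comp (Matrix.traceAddMonoidHom (Fin N) ℂ)) (b * a) := by
  simp [Matrix.trace_mul_comm a b]

omit [NeZero N] in
/-- **`⟨A, Δ_UA⟩ = Σ‖D_νA_μ‖²`**: `Σ_x Σ_μ Re Tr(A_μ(x)^*(Δ_UA)_μ(x)) = Σ_x Σ_μ Σ_ν Σ_{jk}|(D_{U,ν}A_μ)(x)_{jk}|²` ([B9] (3.23) with (3.8) adjointness,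
unitary background). [cite: Balaban1985BackgroundPropagators, (3.8) p.392, (3.23) p.394] -/
theorem sum_re_trace_vecLap (hU : ∀ ν x, (U ν x : Matrix (Fin N) (Fin N) ℂ) ∈ unitary (Matrix (Fin N) (Fin N) ℂ))
    (A : Fin P.d → Site P i → Matrix (Fin N) (Fin N) ℂ) :
    ∑ x : Site P i, ∑ μ : Fin P.d, (((A μ x)ᴴ * vecLap (torusT P i) U A μ x).trace).re
      = ∑ x : Site P i, ∑ μ : Fin P.d, ∑ ν : Fin P.d, ∑ j : Fin N, ∑ k : Fin N, ‖(covD (torusT P i) U ν (A μ) x) j k‖ ^ 2 := by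
  set τ := Complex.reAddGroupHom.comp (Matrix.traceAddMonoidHom (Fin N) ℂ) with hτ
  have hτa : ∀ a : Matrix (Fin N) (Fin N) ℂ, τ a = (a.trace).re := fun a => by simp [hτ]
  -- per `μ, ν`: adjointness of `D_ν`
  have key : ∀ μ ν : Fin P.d, ∑ x : Site P i, ∑ j : Fin N, ∑ k : Fin N, ‖(covD (torusT P i) U ν (A μ) x) j k‖ ^ 2
      = ∑ x : Site P i, τ ((A μ x)ᴴ * covDstar (torusT P i) U ν (covD (torusT P i) U ν (A μ)) x) := by
    intro μ ν
    have h := sum_covD_mul (torusT P i) U τ re_trace_mul_comm ν (fun z => (A μ z)ᴴ) (covD (torusT P i) U ν (A μ))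
    rw [← h]
    refine Finset.sum_congr rfl fun x _ => ?_
    rw [← conjTranspose_covD hU, hτa, re_trace_conjTranspose_mul_self]
  have lhs : ∀ (x : Site P i) (μ : Fin P.d), (((A μ x)ᴴ * vecLap (torusT P i) U A μ x).trace).re
      = ∑ ν : Fin P.d, τ ((A μ x)ᴴ * covDstar (torusT P i) U ν (covD (torusT P i) U ν (A μ)) x) := by
    intro x μ
    rw [vecLap_def, Finset.mul_sum, ← hτa, map_sum]
  calc ∑ x : Site P i, ∑ μ : Fin P.d, (((A μ x)ᴴ * vecLap (torusT P i) U A μ x).trace).re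
      = ∑ x : Site P i, ∑ μ : Fin P.d, ∑ ν : Fin P.d, τ ((A μ x)ᴴ * covDstar (torusT P i) U ν (covD (torusT P i) U ν (A μ)) x) :=
        Finset.sum_congr rfl fun x _ => Finset.sum_congr rfl fun μ _ => lhs x μ
    _ = ∑ μ : Fin P.d, ∑ ν : Fin P.d, ∑ x : Site P i, τ ((A μ x)ᴴ * covDstar (torusT P i) U ν (covD (torusT P i) U ν (A μ)) x) := by
        rw [Finset.sum_comm]; exact Finset.sum_congr rfl fun μ _ => Finset.sum_comm
    _ = ∑ μ : Fin P.d, ∑ ν : Fin P.d, ∑ x : Site P i, ∑ j : Fin N, ∑ k : Fin N, ‖(covD (torusT P i) U ν (A μ) x) j k‖ ^ 2 :=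
        Finset.sum_congr rfl fun μ _ => Finset.sum_congr rfl fun ν _ => (key μ ν).symm
    _ = ∑ x : Site P i, ∑ μ : Fin P.d, ∑ ν : Fin P.d, ∑ j : Fin N, ∑ k : Fin N, ‖(covD (torusT P i) U ν (A μ) x) j k‖ ^ 2 :=
        (Finset.sum_congr rfl fun _ _ => Finset.sum_comm).trans Finset.sum_comm

omit [NeZero N] in
/-- **`⟨A, D*D_UA⟩ = Σ_{p}‖(D_UA)(p)‖²`** over the positively oriented plaquettes ([B9] (3.9) adjointness, unitary background).
[cite: Balaban1985BackgroundPropagators, (3.9) p.392, (3.10) p.392] -/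
theorem sum_re_trace_divP_curl (hU : ∀ ν x, (U ν x : Matrix (Fin N) (Fin N) ℂ) ∈ unitary (Matrix (Fin N) (Fin N) ℂ))
    (A : Fin P.d → Site P i → Matrix (Fin N) (Fin N) ℂ) :
    ∑ x : Site P i, ∑ μ : Fin P.d, (((A μ x)ᴴ * divP (torusT P i) U (curl (torusT P i) U A) μ x).trace).re
      = ∑ x : Site P i, ∑ μ : Fin P.d, ∑ ν : Fin P.d,
          (if μ < ν then ∑ j : Fin N, ∑ k : Fin N, ‖(curl (torusT P i) U A μ ν x) j k‖ ^ 2 else 0) := by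
  set τ := Complex.reAddGroupHom.comp (Matrix.traceAddMonoidHom (Fin N) ℂ) with hτ
  have hτa : ∀ a : Matrix (Fin N) (Fin N) ℂ, τ a = (a.trace).re := fun a => by simp [hτ]
  have h := sum_curl_mul (torusT P i) U τ re_trace_mul_comm (fun κ z => (A κ z)ᴴ) (curl (torusT P i) U A)
  have h' : ∑ x : Site P i, ∑ μ : Fin P.d, (((A μ x)ᴴ * divP (torusT P i) U (curl (torusT P i) U A) μ x).trace).re
      = ∑ x : Site P i, ∑ μ : Fin P.d, τ ((fun κ z => (A κ z)ᴴ) μ x * divP (torusT P i) U (curl (torusT P i) U A) μ x) :=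
    Finset.sum_congr rfl fun x _ => Finset.sum_congr rfl fun μ _ => (hτa _).symm
  rw [h', ← h]
  refine Finset.sum_congr rfl fun x _ => Finset.sum_congr rfl fun μ _ => Finset.sum_congr rfl fun ν _ => ?_
  split_ifs with hlt
  · rw [← conjTranspose_curl hU, hτa, re_trace_conjTranspose_mul_self]
  · rfl

omit [NeZero N] in
/-- **`⟨A, DD*A⟩ = Σ_x‖(D*A)(x)‖²`** ([B9] (3.8) adjointness, unitary background). [cite: Balaban1985BackgroundPropagators, (3.8) p.392] -/
theorem sum_re_trace_covD_divB (hU : ∀ ν x, (U ν x : Matrix (Fin N) (Fin N) ℂ) ∈ unitary (Matrix (Fin N) (Fin N) ℂ))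
    (A : Fin P.d → Site P i → Matrix (Fin N) (Fin N) ℂ) :
    ∑ x : Site P i, ∑ μ : Fin P.d, (((A μ x)ᴴ * covD (torusT P i) U μ (divB (torusT P i) U A) x).trace).re
      = ∑ x : Site P i, ∑ j : Fin N, ∑ k : Fin N, ‖(divB (torusT P i) U A x) j k‖ ^ 2 := by
  set τ := Complex.reAddGroupHom.comp (Matrix.traceAddMonoidHom (Fin N) ℂ) with hτ
  have hτa : ∀ a : Matrix (Fin N) (Fin N) ℂ, τ a = (a.trace).re := fun a => by simp [hτ]
  have h := sum_sum_covD_mul (torusT P i) U τ re_trace_mul_comm (fun z => (divB (torusT P i) U A z)ᴴ) A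
  -- the left side of `h` is our left side by the symmetry of the pairing
  have hl : ∑ x : Site P i, ∑ μ : Fin P.d, τ (covD (torusT P i) U μ (fun z => (divB (torusT P i) U A z)ᴴ) x * A μ x)
      = ∑ x : Site P i, ∑ μ : Fin P.d, (((A μ x)ᴴ * covD (torusT P i) U μ (divB (torusT P i) U A) x).trace).re := by
    refine Finset.sum_congr rfl fun x _ => Finset.sum_congr rfl fun μ _ => ?_
    rw [← conjTranspose_covD hU, hτa, ← re_trace_conjTranspose_mul_comm]
  have hr : ∑ x : Site P i, τ ((fun z => (divB (torusT P i) U A z)ᴴ) x * divB (torusT P i) U A x)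
      = ∑ x : Site P i, ∑ j : Fin N, ∑ k : Fin N, ‖(divB (torusT P i) U A x) j k‖ ^ 2 :=
    Finset.sum_congr rfl fun x _ => by rw [hτa, re_trace_conjTranspose_mul_self]
  rw [← hl, h, hr]

/-- **THE CURVATURE PAIRING IS SMALL** (the «regularity condition (14)» clause of the (136) sentence, `L²` form): if every plaquette variable
of the unitary background is within `a` of `1`, then `|Σ_x Σ_μ Re Tr(A_μ(x)^*(𝒦A)_μ(x))| ≤ 2da·Σ_x Σ_μ Σ_{jk}|A_μ(x)_{jk}|²`.
[cite: Balaban1985Variational, (135)-(136) p.298] -/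
theorem abs_sum_re_trace_curvOp_le (hU : ∀ ν x, (U ν x : Matrix (Fin N) (Fin N) ℂ) ∈ unitary (Matrix (Fin N) (Fin N) ℂ))
    {a : ℝ} (hplaqU : ∀ (μ ν : Fin P.d) (x : Site P i), ‖(plaqU (torusT P i) U μ ν x : Matrix (Fin N) (Fin N) ℂ) - 1‖ ≤ a)
    (A : Fin P.d → Site P i → Matrix (Fin N) (Fin N) ℂ) :
    |∑ x : Site P i, ∑ μ : Fin P.d, (((A μ x)ᴴ * curvOp (torusT P i) U A μ x).trace).re|
      ≤ 2 * P.d * a * ∑ x : Site P i, ∑ μ : Fin P.d, ∑ j : Fin N, ∑ k : Fin N, ‖(A μ x) j k‖ ^ 2 := by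
  have hU1 : ∀ μ x, ‖(U μ x : Matrix (Fin N) (Fin N) ℂ)‖ ≤ 1 ∧ ‖(((U μ x)⁻¹ : (Matrix (Fin N) (Fin N) ℂ)ˣ) : Matrix (Fin N) (Fin N) ℂ)‖ ≤ 1 :=
    fun μ x => mem_U1_of_unitary (hU μ x)
  -- per summand
  have hsum : ∀ (x : Site P i) (μ : Fin P.d), (((A μ x)ᴴ * curvOp (torusT P i) U A μ x).trace).re
      = ∑ ν : Fin P.d, (((A μ x)ᴴ * R (transp (torusT P i) U μ ν x)
          (R (plaqU' (torusT P i) U μ ν x) (A ν ((torusT P i ν).symm (torusT P i μ x))) - A ν ((torusT P i ν).symm (torusT P i μ x)))).trace).re := by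
    intro x μ
    rw [curvOp_def, Finset.mul_sum, Matrix.trace_sum, Complex.re_sum]
  have hterm : ∀ (x : Site P i) (μ ν : Fin P.d),
      |(((A μ x)ᴴ * R (transp (torusT P i) U μ ν x)
          (R (plaqU' (torusT P i) U μ ν x) (A ν ((torusT P i ν).symm (torusT P i μ x))) - A ν ((torusT P i ν).symm (torusT P i μ x)))).trace).re|
        ≤ a * (∑ j : Fin N, ∑ k : Fin N, ‖(A μ x) j k‖ ^ 2 + ∑ j : Fin N, ∑ k : Fin N, ‖(A ν ((torusT P i ν).symm (torusT P i μ x))) j k‖ ^ 2) := by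
    intro x μ ν
    have ht : (transp (torusT P i) U μ ν x : Matrix (Fin N) (Fin N) ℂ) ∈ unitary (Matrix (Fin N) (Fin N) ℂ) := by
      rw [B11Eq135Weitzenbock.transp_def, Units.val_mul]
      exact mul_mem (hU _ _) (inv_mem_unitary (hU _ _))
    have hW : (plaqU' (torusT P i) U μ ν x : Matrix (Fin N) (Fin N) ℂ) ∈ unitary (Matrix (Fin N) (Fin N) ℂ) := by
      rw [B11Eq135Weitzenbock.plaqU'_def, Units.val_mul, Units.val_mul, Units.val_mul]
      exact mul_mem (mul_mem (mul_mem (hU _ _) (inv_mem_unitary (hU _ _))) (inv_mem_unitary (hU _ _))) (hU _ _)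
    have hWa : ‖(plaqU' (torusT P i) U μ ν x : Matrix (Fin N) (Fin N) ℂ) - 1‖ ≤ a :=
      (norm_plaqU'_sub_one_le (torusT P i) U torusT_comm hU1 μ ν x).trans (hplaqU μ ν _)
    exact abs_re_trace_curv_le ht hW hWa _ _
  -- sum up
  have h1 : |∑ x : Site P i, ∑ μ : Fin P.d, (((A μ x)ᴴ * curvOp (torusT P i) U A μ x).trace).re|
      ≤ ∑ x : Site P i, ∑ μ : Fin P.d, ∑ ν : Fin P.d,
          a * (∑ j : Fin N, ∑ k : Fin N, ‖(A μ x) j k‖ ^ 2 + ∑ j : Fin N, ∑ k : Fin N, ‖(A ν ((torusT P i ν).symm (torusT P i μ x))) j k‖ ^ 2) := by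
    refine (Finset.abs_sum_le_sum_abs _ _).trans (Finset.sum_le_sum fun x _ => ?_)
    refine (Finset.abs_sum_le_sum_abs _ _).trans (Finset.sum_le_sum fun μ _ => ?_)
    rw [hsum]
    exact (Finset.abs_sum_le_sum_abs _ _).trans (Finset.sum_le_sum fun ν _ => hterm x μ ν)
  -- the shifted sum is the unshifted one
  have hshift : ∀ μ ν : Fin P.d, ∑ x : Site P i, ∑ j : Fin N, ∑ k : Fin N, ‖(A ν ((torusT P i ν).symm (torusT P i μ x))) j k‖ ^ 2
      = ∑ x : Site P i, ∑ j : Fin N, ∑ k : Fin N, ‖(A ν x) j k‖ ^ 2 := by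
    intro μ ν
    exact Equiv.sum_comp ((torusT P i μ).trans (torusT P i ν).symm) (fun z => ∑ j : Fin N, ∑ k : Fin N, ‖(A ν z) j k‖ ^ 2)
  have h2 : ∑ x : Site P i, ∑ μ : Fin P.d, ∑ ν : Fin P.d,
        a * (∑ j : Fin N, ∑ k : Fin N, ‖(A μ x) j k‖ ^ 2 + ∑ j : Fin N, ∑ k : Fin N, ‖(A ν ((torusT P i ν).symm (torusT P i μ x))) j k‖ ^ 2)
      = 2 * P.d * a * ∑ x : Site P i, ∑ μ : Fin P.d, ∑ j : Fin N, ∑ k : Fin N, ‖(A μ x) j k‖ ^ 2 := by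
    simp only [mul_add, Finset.sum_add_distrib]
    have e1 : ∑ x : Site P i, ∑ μ : Fin P.d, ∑ _ν : Fin P.d, a * ∑ j : Fin N, ∑ k : Fin N, ‖(A μ x) j k‖ ^ 2
        = P.d * a * ∑ x : Site P i, ∑ μ : Fin P.d, ∑ j : Fin N, ∑ k : Fin N, ‖(A μ x) j k‖ ^ 2 := by
      simp only [Finset.sum_const, Finset.card_univ, Fintype.card_fin, nsmul_eq_mul, Finset.mul_sum]
      refine Finset.sum_congr rfl fun x _ => Finset.sum_congr rfl fun μ _ => by ring
    have e2 : ∑ x : Site P i, ∑ μ : Fin P.d, ∑ ν : Fin P.d, a * ∑ j : Fin N, ∑ k : Fin N, ‖(A ν ((torusT P i ν).symm (torusT P i μ x))) j k‖ ^ 2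
        = P.d * a * ∑ x : Site P i, ∑ μ : Fin P.d, ∑ j : Fin N, ∑ k : Fin N, ‖(A μ x) j k‖ ^ 2 := by
      have s1 : ∑ x : Site P i, ∑ μ : Fin P.d, ∑ ν : Fin P.d, a * ∑ j : Fin N, ∑ k : Fin N, ‖(A ν ((torusT P i ν).symm (torusT P i μ x))) j k‖ ^ 2
          = ∑ μ : Fin P.d, ∑ ν : Fin P.d, ∑ x : Site P i, a * ∑ j : Fin N, ∑ k : Fin N, ‖(A ν ((torusT P i ν).symm (torusT P i μ x))) j k‖ ^ 2 := by
        rw [Finset.sum_comm]; exact Finset.sum_congr rfl fun μ _ => Finset.sum_comm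
      have s2 : ∀ μ ν : Fin P.d, ∑ x : Site P i, a * ∑ j : Fin N, ∑ k : Fin N, ‖(A ν ((torusT P i ν).symm (torusT P i μ x))) j k‖ ^ 2
          = a * ∑ x : Site P i, ∑ j : Fin N, ∑ k : Fin N, ‖(A ν x) j k‖ ^ 2 := by
        intro μ ν; rw [← Finset.mul_sum, hshift μ ν]
      have s3 : ∑ x : Site P i, ∑ μ : Fin P.d, ∑ j : Fin N, ∑ k : Fin N, ‖(A μ x) j k‖ ^ 2
          = ∑ μ : Fin P.d, ∑ x : Site P i, ∑ j : Fin N, ∑ k : Fin N, ‖(A μ x) j k‖ ^ 2 := Finset.sum_comm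
      rw [s1, s3]
      simp only [s2]
      rw [Finset.sum_const, Finset.card_univ, Fintype.card_fin, nsmul_eq_mul, ← Finset.mul_sum]
      ring
    rw [e1, e2]; ring
  exact h1.trans h2.le

/-- **THE QUADRATIC-FORM WEITZENBÖCK INEQUALITY AT A UNITARY SMALL-FIELD BACKGROUND** ((135) of [Balaban1985Variational] paired with `A`, the
adjointness (3.8)/(3.9) of [Balaban1985BackgroundPropagators], and the curvature clause): on the torus `T^{(i)}`, for every unitary background
`U` whose plaquette variables are within `a` of `1` and every `M_N(ℂ)`-valued bond field `A`,
`Σ_x Σ_μ Σ_ν ‖(D_{U,ν}A_μ)(x)‖²_HS ≤ Σ_x Σ_{μ<ν} ‖(D_UA)(p_{μν}(x))‖²_HS + Σ_x ‖(D*_UA)(x)‖²_HS + 2da·Σ_x Σ_μ ‖A_μ(x)‖²_HS`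
(`‖X‖²_HS = Σ_{jk}|X_jk|²`): the covariant gradient form is the curl form plus the divergence form up to a curvature term of relative size `a`.
[cite: Balaban1985Variational, (135) p.298; Balaban1985BackgroundPropagators, (3.8)-(3.10) p.392] -/
theorem sum_covD_sq_le_curl_sq_add_divB_sq (hU : ∀ ν x, (U ν x : Matrix (Fin N) (Fin N) ℂ) ∈ unitary (Matrix (Fin N) (Fin N) ℂ))
    {a : ℝ} (hplaqU : ∀ (μ ν : Fin P.d) (x : Site P i), ‖(plaqU (torusT P i) U μ ν x : Matrix (Fin N) (Fin N) ℂ) - 1‖ ≤ a)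
    (A : Fin P.d → Site P i → Matrix (Fin N) (Fin N) ℂ) :
    ∑ x : Site P i, ∑ μ : Fin P.d, ∑ ν : Fin P.d, ∑ j : Fin N, ∑ k : Fin N, ‖(covD (torusT P i) U ν (A μ) x) j k‖ ^ 2
      ≤ ∑ x : Site P i, ∑ μ : Fin P.d, ∑ ν : Fin P.d,
          (if μ < ν then ∑ j : Fin N, ∑ k : Fin N, ‖(curl (torusT P i) U A μ ν x) j k‖ ^ 2 else 0)
        + ∑ x : Site P i, ∑ j : Fin N, ∑ k : Fin N, ‖(divB (torusT P i) U A x) j k‖ ^ 2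
        + 2 * P.d * a * ∑ x : Site P i, ∑ μ : Fin P.d, ∑ j : Fin N, ∑ k : Fin N, ‖(A μ x) j k‖ ^ 2 := by
  -- (135) paired with `A`, summed
  have h135 : ∑ x : Site P i, ∑ μ : Fin P.d, (((A μ x)ᴴ * hodgeOp (torusT P i) U A μ x).trace).re
      = ∑ x : Site P i, ∑ μ : Fin P.d, (((A μ x)ᴴ * vecLap (torusT P i) U A μ x).trace).re
        - ∑ x : Site P i, ∑ μ : Fin P.d, (((A μ x)ᴴ * curvOp (torusT P i) U A μ x).trace).re := by
    rw [← Finset.sum_sub_distrib]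
    refine Finset.sum_congr rfl fun x _ => ?_
    rw [← Finset.sum_sub_distrib]
    refine Finset.sum_congr rfl fun μ _ => ?_
    rw [eq135_torus, mul_sub, Matrix.trace_sub, Complex.sub_re]
  have hhodge : ∑ x : Site P i, ∑ μ : Fin P.d, (((A μ x)ᴴ * hodgeOp (torusT P i) U A μ x).trace).re
      = ∑ x : Site P i, ∑ μ : Fin P.d, ∑ ν : Fin P.d,
          (if μ < ν then ∑ j : Fin N, ∑ k : Fin N, ‖(curl (torusT P i) U A μ ν x) j k‖ ^ 2 else 0)
        + ∑ x : Site P i, ∑ j : Fin N, ∑ k : Fin N, ‖(divB (torusT P i) U A x) j k‖ ^ 2 := by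
    rw [← sum_re_trace_divP_curl hU, ← sum_re_trace_covD_divB hU, ← Finset.sum_add_distrib]
    refine Finset.sum_congr rfl fun x _ => ?_
    rw [← Finset.sum_add_distrib]
    refine Finset.sum_congr rfl fun μ _ => ?_
    rw [hodgeOp_def, mul_add, Matrix.trace_add, Complex.add_re]
  have hcurv := abs_sum_re_trace_curvOp_le hU hplaqU A
  rw [← sum_re_trace_vecLap hU, ← hhodge, h135]
  have := (abs_le.mp hcurv).2
  linarith

end Torus

end Summit.QuantumFields.YangMills.Theorems.Prop7CovariantCoercivity

end
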